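import Summits.CriticalPhenomena.SAWScalingLimit.Theorems.SAWDevelopingMapHexConjectureReflexWedgeGeometryCoord
import Literature.Probability.RandomPlanarGeometry.HexSAWPathRigidity

/-!
# Reflex-wedge geometry, part C: the bottom zigzag to a `0°`-ray dart has winding `+π`

Support file for the crux `HexConjecture` (stmt-CriticalPhenomena-0808), line
`marginal-reflex-wedge-cauchy-kernel`, stub `stub_reflexWedgeGeometry`, conjunct (iii): for every
`0°`-ray dart `((n,-1);1) → ((n,0);0)`, `n ≥ 1`, of the truncated `300°` wedge `W_N` there is an EXPLICIT
self-avoiding walk of `W_N` from the root mid-edge `cornerEdge` to it — the bottom zigzag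
`cornerIn = D₀, U₁, D₁, …, Uₙ, Dₙ` (`Dₖ = ((k,-1);1)`, `Uₖ = ((k,-1);0)`) — whose winding is `+π`
(**`reflexWedge_rayZero_walk`**; coordinates from `…ReflexWedgeGeometryCoord.lean`). By the rigidity of the winding between boundary mid-edges
(`HexMidEdgeSAW.winding_eq_of_mem_boundary`, `HexSAWPathRigidity.lean`) every walk to such a dart then
has winding `+π` (assembled in the stub file).

The winding is computed combinatorially: `HexMidEdgeSAW.winding_eq_pturn_code` (`HexSAWPathRigidity.lean`)
expresses it as `(π/3) · pturn` of the code of the walk in the coordinate model `HV` under a chart taking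
the root dart to the standard entrance `wOut → hvOrigin`; here the chart is the coordinate map `hvIso`
followed by the central flip `HV.flip` (`chart_cornerOut`, `chart_cornerIn`, `chart_affine`), the code is
the zigzag `wOut, hvOrigin, (-1,0,t), (-1,0,f), …, (-n,0,t), (-n,0,f), (-n,-1,t)` and its turn sum is
`1 + 1 + (-1 + 1)(n-1) + 1 = 3` (`pturn_rayZero_code`; local turns decided at the origin and translated by
`turn_tr`). Folklore lattice bookkeeping; no named fact is used.
-/

open scoped BigOperators Classical
open Literature.Probability.LatticeModels Literature.Probability.RandomPlanarGeometry
  Literature.Probability.RandomPlanarGeometry.SAW Literature.Probability.RandomPlanarGeometry.SAW.HV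

namespace Summit.CriticalPhenomena.SAWScalingLimit.Theorems.HexConjecture.MarginalWedge.ReflexGeometry

/-! ### Equality of faces in coordinates -/

/-- Two faces given in coordinates coincide iff their coordinates do. [folklore] -/
theorem mk_eq_mk_iff {a b a' b' : ℤ} {t t' : Fin 2} :
    ((((![a, b] : Site 2), t) : HexVertex) = ((![a', b'] : Site 2), t')) ↔ a = a' ∧ b = b' ∧ t = t' := by
  constructor
  · intro h
    obtain ⟨h1, h2⟩ := Prod.mk.inj h
    exact ⟨by simpa using congrFun h1 0, by simpa using congrFun h1 1, h2⟩
  · rintro ⟨rfl, rfl, rfl⟩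
    rfl

/-! ### The chart `hvIso.trans HV.flip` -/

/-- The chart in coordinates. [folklore] -/
theorem chart_apply (x : Site 2) (t : Fin 2) :
    (hvIso.trans HV.flip) ((x, t) : HexVertex) = (-x 0, -x 1 - 1, !decide (t = 1)) := rfl

/-- The chart on an up-face. [folklore] -/
theorem chart_apply_zero (a b : ℤ) :
    (hvIso.trans HV.flip) (((![a, b] : Site 2), (0 : Fin 2)) : HexVertex) = (-a, -b - 1, true) := by
  rw [chart_apply]; simp

/-- The chart on a down-face. [folklore] -/
theorem chart_apply_one (a b : ℤ) :
    (hvIso.trans HV.flip) (((![a, b] : Site 2), (1 : Fin 2)) : HexVertex) = (-a, -b - 1, false) := by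
  rw [chart_apply]; simp

/-- The chart takes the outer root vertex to the standard outer vertex `wOut`. [folklore] -/
theorem chart_cornerOut : (hvIso.trans HV.flip) cornerOut = wOut := by
  rw [cornerOut, chart_apply_zero, wOut]; norm_num

/-- The chart takes the inner root vertex to `hvOrigin`. [folklore] -/
theorem chart_cornerIn : (hvIso.trans HV.flip) cornerIn = hvOrigin := by
  rw [cornerIn, chart_apply_one, hvOrigin]; norm_num

/-- The chart is complex-affine on embedded positions (`z ↦ -3z + 3`). [folklore] -/
theorem chart_affine (f : HexVertex) :
    emb (pos ((hvIso.trans HV.flip) f)) = (-1 * 3) * hexCenter f + (-1 * 0 + emb (3, 0)) := by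
  have h0 : ∀ g, emb (pos (hvIso g)) = 3 * hexCenter g + 0 := emb_pos_toHV
  exact chart_trans (Φ := hvIso) h0 HV.flip emb_pos_flip f

/-! ### Turn sum of the code of the bottom zigzag -/

/-- Translating a vertex of the coordinate model along the first axis. [folklore] -/
theorem tr_mk (c a b : ℤ) (β : Bool) : tr (c, 0) (a, b, β) = (a + c, b, β) := by
  simp [tr]

/-- The turn `(-c,0,t) → (-c,0,f) → (-c-1,0,t)` is a right turn. [folklore] -/
theorem turn_zig (c : ℤ) : turn (-c, 0, true) (-c, 0, false) (-c - 1, 0, true) = -1 := by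
  have h := turn_tr (-c, 0) (0, 0, true) (0, 0, false) (-1, 0, true)
  rw [show turn ((0 : ℤ), (0 : ℤ), true) (0, 0, false) (-1, 0, true) = -1 by decide] at h
  simp only [tr_mk, zero_add] at h
  rw [show -c - 1 = -1 + -c by ring]
  exact h

/-- The turn `(-c,0,f) → (-c-1,0,t) → (-c-1,0,f)` is a left turn. [folklore] -/
theorem turn_zag (c : ℤ) : turn (-c, 0, false) (-c - 1, 0, true) (-c - 1, 0, false) = 1 := by
  have h := turn_tr (-c, 0) (0, 0, false) (-1, 0, true) (-1, 0, false)
  rw [show turn ((0 : ℤ), (0 : ℤ), false) (-1, 0, true) (-1, 0, false) = 1 by decide] at h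
  simp only [tr_mk, zero_add] at h
  rw [show -c - 1 = -1 + -c by ring]
  exact h

/-- The exit turn `(-c,0,t) → (-c,0,f) → (-c,-1,t)` is a left turn. [folklore] -/
theorem turn_exit (c : ℤ) : turn (-c, 0, true) (-c, 0, false) (-c, -1, true) = 1 := by
  have h := turn_tr (-c, 0) (0, 0, true) (0, 0, false) (0, -1, true)
  rw [show turn ((0 : ℤ), (0 : ℤ), true) (0, 0, false) (0, -1, true) = 1 by decide] at h
  simpa only [tr_mk, zero_add] using h

/-- Appending two vertices to a path with at least two vertices adds two turns. [folklore] -/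
theorem pturn_cons_cons_append_pair (u v : HV) (L : List HV) (x y z w : HV) :
    pturn (u :: v :: (L ++ [x, y] ++ [z, w])) = pturn (u :: v :: (L ++ [x, y])) + (turn x y z + turn y z w) := by
  have h := pturn_append_cons_cons (u :: v :: L) [z, w] x y
  simpa [List.append_assoc] using h

/-- Appending one vertex to a path with at least two vertices adds one turn. [folklore] -/
theorem pturn_cons_cons_append_single (u v : HV) (L : List HV) (x y z : HV) :
    pturn (u :: v :: (L ++ [x, y] ++ [z])) = pturn (u :: v :: (L ++ [x, y])) + turn x y z := by
  have h := pturn_append_cons_cons (u :: v :: L) [z] x y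
  simpa [List.append_assoc] using h

/-- One period of the code. [folklore] -/
theorem code_range_succ (m : ℕ) :
    (List.range (m + 1)).flatMap (fun k : ℕ => [((-((k : ℤ) + 1), 0, true) : HV), (-((k : ℤ) + 1), 0, false)]) =
      (List.range m).flatMap (fun k : ℕ => [((-((k : ℤ) + 1), 0, true) : HV), (-((k : ℤ) + 1), 0, false)]) ++
        [((-((m : ℤ) + 1), 0, true) : HV), (-((m : ℤ) + 1), 0, false)] := by
  rw [List.range_succ, List.flatMap_append, List.flatMap_singleton]

/-- The right turn at `Dₘ₊₁` towards `Uₘ₊₂`, in the code. [folklore] -/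
theorem turn_zig' (m : ℕ) :
    turn (-((m : ℤ) + 1), 0, true) (-((m : ℤ) + 1), 0, false) (-(((m + 1 : ℕ) : ℤ) + 1), 0, true) = -1 := by
  rw [show -(((m + 1 : ℕ) : ℤ) + 1) = -((m : ℤ) + 1) - 1 by push_cast; ring]
  exact turn_zig _

/-- The left turn at `Uₘ₊₂` towards `Dₘ₊₂`, in the code. [folklore] -/
theorem turn_zag' (m : ℕ) :
    turn (-((m : ℤ) + 1), 0, false) (-(((m + 1 : ℕ) : ℤ) + 1), 0, true) (-(((m + 1 : ℕ) : ℤ) + 1), 0, false) = 1 := by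
  rw [show -(((m + 1 : ℕ) : ℤ) + 1) = -((m : ℤ) + 1) - 1 by push_cast; ring]
  exact turn_zag _

/-- The left exit turn at `Dₘ₊₁` towards the outer vertex of the dart, in the code. [folklore] -/
theorem turn_exit' (m : ℕ) :
    turn (-((m : ℤ) + 1), 0, true) (-((m : ℤ) + 1), 0, false) (-((m + 1 : ℕ) : ℤ), -1, true) = 1 := by
  rw [show -((m + 1 : ℕ) : ℤ) = -((m : ℤ) + 1) by push_cast; ring]
  exact turn_exit _

/-- The turn sum of the code up to `Dₘ₊₁` is `2` (`+1` at `D₀`, `+1` at `U₁`, then `-1, +1` per period).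
[folklore] -/
theorem pturn_rayZero_prefix (m : ℕ) :
    pturn (wOut :: hvOrigin ::
      (List.range (m + 1)).flatMap (fun k : ℕ => [((-((k : ℤ) + 1), 0, true) : HV), (-((k : ℤ) + 1), 0, false)])) = 2 := by
  induction m with
  | zero => decide
  | succ m ih =>
    rw [code_range_succ (m + 1), code_range_succ m, pturn_cons_cons_append_pair, ← code_range_succ m, ih,
      turn_zig', turn_zag']
    norm_num

/-- **The turn sum of the code of the bottom zigzag to the `n`-th `0°`-ray dart is `3`** (`n ≥ 1`).
[folklore] -/
theorem pturn_rayZero_code (n : ℕ) (hn : 1 ≤ n) :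
    pturn (wOut :: hvOrigin ::
      ((List.range n).flatMap (fun k : ℕ => [((-((k : ℤ) + 1), 0, true) : HV), (-((k : ℤ) + 1), 0, false)]) ++
        [((-(n : ℤ), -1, true) : HV)])) = 3 := by
  obtain ⟨m, rfl⟩ : ∃ m : ℕ, n = m + 1 := ⟨n - 1, by omega⟩
  rw [code_range_succ m, pturn_cons_cons_append_single, ← code_range_succ m, pturn_rayZero_prefix m,
    turn_exit']
  norm_num

/-! ### The bottom zigzag as a self-avoiding walk of `W_N` -/

/-- One period of the bottom zigzag `U₁, D₁, …`. [folklore] -/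
theorem zigzag_range_succ (m : ℕ) :
    (List.range (m + 1)).flatMap (fun k : ℕ =>
      [(((![(k : ℤ) + 1, -1] : Site 2), (0 : Fin 2)) : HexVertex), ((![(k : ℤ) + 1, -1] : Site 2), (1 : Fin 2))]) =
    (List.range m).flatMap (fun k : ℕ =>
      [(((![(k : ℤ) + 1, -1] : Site 2), (0 : Fin 2)) : HexVertex), ((![(k : ℤ) + 1, -1] : Site 2), (1 : Fin 2))]) ++
      [(((![(m : ℤ) + 1, -1] : Site 2), (0 : Fin 2)) : HexVertex), ((![(m : ℤ) + 1, -1] : Site 2), (1 : Fin 2))] := by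
  rw [List.range_succ, List.flatMap_append, List.flatMap_singleton]

/-- Membership in the bottom zigzag. [folklore] -/
theorem mem_zigzag_iff (n : ℕ) (x : HexVertex) :
    x ∈ (List.range n).flatMap (fun k : ℕ =>
      [(((![(k : ℤ) + 1, -1] : Site 2), (0 : Fin 2)) : HexVertex), ((![(k : ℤ) + 1, -1] : Site 2), (1 : Fin 2))]) ↔
    ∃ k : ℕ, k < n ∧ (x = ((![(k : ℤ) + 1, -1] : Site 2), (0 : Fin 2)) ∨ x = ((![(k : ℤ) + 1, -1] : Site 2), (1 : Fin 2))) := by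
  simp [List.mem_flatMap, List.mem_range]

/-- The bottom zigzag `D₀, U₁, D₁, …, Uₙ, Dₙ` is a lattice path ending at `Dₙ`. [folklore] -/
theorem zigzag_chain (n : ℕ) :
    List.IsChain hexGraph.Adj (cornerIn :: (List.range n).flatMap (fun k : ℕ =>
      [(((![(k : ℤ) + 1, -1] : Site 2), (0 : Fin 2)) : HexVertex), ((![(k : ℤ) + 1, -1] : Site 2), (1 : Fin 2))])) ∧
    (cornerIn :: (List.range n).flatMap (fun k : ℕ =>
      [(((![(k : ℤ) + 1, -1] : Site 2), (0 : Fin 2)) : HexVertex), ((![(k : ℤ) + 1, -1] : Site 2), (1 : Fin 2))])).getLast? =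
      some (((![(n : ℤ), -1] : Site 2), (1 : Fin 2)) : HexVertex) := by
  induction n with
  | zero => simp [cornerIn]
  | succ m ih =>
    obtain ⟨hc, hl⟩ := ih
    rw [zigzag_range_succ, ← List.cons_append]
    refine ⟨List.IsChain.append hc (List.isChain_pair.2 (hexGraph_adj_up _ _)) ?_, ?_⟩
    · intro x hx y hy
      rw [hl] at hx
      simp only [Option.mem_def, Option.some.injEq, List.head?_cons] at hx hy
      subst hx; subst hy
      exact hexGraph_adj_e0 (m : ℤ) (-1)
    · rw [List.getLast?_append]
      push_cast
      rfl

/-- The bottom zigzag is self-avoiding. [folklore] -/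
theorem zigzag_nodup (n : ℕ) :
    (cornerIn :: (List.range n).flatMap (fun k : ℕ =>
      [(((![(k : ℤ) + 1, -1] : Site 2), (0 : Fin 2)) : HexVertex), ((![(k : ℤ) + 1, -1] : Site 2), (1 : Fin 2))])).Nodup := by
  refine List.nodup_cons.2 ⟨?_, List.nodup_flatMap.2 ⟨fun k _ => ?_, ?_⟩⟩
  · rw [mem_zigzag_iff]
    rintro ⟨k, -, h | h⟩ <;> rw [cornerIn, mk_eq_mk_iff] at h <;> omega
  · simp
  · refine List.pairwise_lt_range.imp fun {k k'} hlt => ?_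
    simp only [Function.onFun]
    rw [List.disjoint_left]
    intro x hx hx'
    simp only [List.mem_cons, List.not_mem_nil, or_false] at hx hx'
    rcases hx with rfl | rfl <;> rcases hx' with h | h <;> rw [mk_eq_mk_iff] at h <;> omega

/-- The outer root vertex is not on the bottom zigzag. [folklore] -/
theorem cornerOut_not_mem_zigzag (n : ℕ) :
    cornerOut ∉ (cornerIn :: (List.range n).flatMap (fun k : ℕ =>
      [(((![(k : ℤ) + 1, -1] : Site 2), (0 : Fin 2)) : HexVertex), ((![(k : ℤ) + 1, -1] : Site 2), (1 : Fin 2))])) := by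
  rw [List.mem_cons, mem_zigzag_iff, cornerOut, cornerIn, mk_eq_mk_iff]
  rintro (h | ⟨k, -, h | h⟩) <;> [skip; rw [mk_eq_mk_iff] at h; rw [mk_eq_mk_iff] at h] <;> omega

/-- The outer vertex of the `n`-th `0°`-ray dart is not on the bottom zigzag. [folklore] -/
theorem rayZero_outer_not_mem_zigzag (n : ℕ) :
    (((![(n : ℤ), 0] : Site 2), (0 : Fin 2)) : HexVertex) ∉ (cornerIn :: (List.range n).flatMap (fun k : ℕ =>
      [(((![(k : ℤ) + 1, -1] : Site 2), (0 : Fin 2)) : HexVertex), ((![(k : ℤ) + 1, -1] : Site 2), (1 : Fin 2))])) := by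
  rw [List.mem_cons, mem_zigzag_iff, cornerIn, mk_eq_mk_iff]
  rintro (h | ⟨k, -, h | h⟩) <;> [skip; rw [mk_eq_mk_iff] at h; rw [mk_eq_mk_iff] at h] <;> omega

/-- The bottom zigzag stays in `W_N` as soon as the outer vertex of the dart is within radius `N`
(`9‖c(Uₖ)‖² = 9k² + 3`, `9‖c(Dₖ)‖² = 9k² + 9k + 3 ≤ 9‖c(outer)‖² = 9n² + 9n + 3`). [folklore] -/
theorem zigzag_subset {Λ : Finset HexVertex} {N : ℝ} (hN : 1 ≤ N) (hW : IsReflexWedgeTruncation Λ N) (n : ℕ)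
    (hw : ‖hexCenter (((![(n : ℤ), 0] : Site 2), (0 : Fin 2)) : HexVertex)‖ < N) :
    ∀ x ∈ (cornerIn :: (List.range n).flatMap (fun k : ℕ =>
      [(((![(k : ℤ) + 1, -1] : Site 2), (0 : Fin 2)) : HexVertex), ((![(k : ℤ) + 1, -1] : Site 2), (1 : Fin 2))])),
      x ∈ Λ := by
  intro x hx
  rcases List.mem_cons.1 hx with rfl | hx
  · exact FluxLine.cornerIn_mem hN hW
  · obtain ⟨k, hk, rfl | rfl⟩ := (mem_zigzag_iff n x).1 hx
    · rw [mem_wedge_iff hW]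
      refine ⟨lt_of_le_of_lt ?_ hw, by norm_num⟩
      have hk' : (k : ℤ) + 1 ≤ n := by exact_mod_cast hk
      rw [norm_center_le_iff]
      norm_num
      nlinarith [mul_self_le_mul_self (by positivity : (0 : ℤ) ≤ (k : ℤ) + 1) hk']
    · rw [mem_wedge_iff hW]
      refine ⟨lt_of_le_of_lt ?_ hw, by norm_num⟩
      have hk' : (k : ℤ) + 1 ≤ n := by exact_mod_cast hk
      rw [norm_center_le_iff]
      norm_num
      nlinarith [mul_self_le_mul_self (by positivity : (0 : ℤ) ≤ (k : ℤ) + 1) hk']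

/-- The edge list of a self-avoiding vertex list extended by a first edge to an outside vertex `u` and a
last edge to an outside vertex `e`, `u, e` off the list and not both ends of one of these two edges, is
duplicate-free. [folklore] -/
theorem edges_nodup_ext {V : List HexVertex} (hV : V.Nodup) {u h l e : HexVertex} (hu : u ∉ V) (he : e ∉ V)
    (hh : h ∈ V) (hhe : h ≠ l ∨ u ≠ e) :
    (s(h, u) :: (List.zipWith (fun x y => s(x, y)) V V.tail ++ [s(l, e)])).Nodup := by
  have hE := edges_nodup hV
  refine List.nodup_cons.2 ⟨?_, List.nodup_append.2 ⟨hE, List.nodup_singleton _, ?_⟩⟩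
  · rw [List.mem_append, List.mem_singleton, not_or]
    constructor
    · exact fun hm => hu (forall_mem_of_mem_edges _ _ hm u (Sym2.mem_mk_right h u))
    · intro heq
      have hu' : u ∈ s(l, e) := heq ▸ Sym2.mem_mk_right h u
      rcases Sym2.mem_iff.1 hu' with rfl | rfl
      · -- `u = l`: then `h ∈ s(l, e) = s(u, e)` forces `h = u` or `h = e`, both off `V`
        have hh' : h ∈ s(u, e) := heq ▸ Sym2.mem_mk_left h u
        rcases Sym2.mem_iff.1 hh' with rfl | rfl
        · exact hu hh
        · exact he hh
      · -- `u = e`: then `h = l`... excluded unless `h ≠ l`, in which case `s(h,u) = s(l,u)` forces `h = l`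
        rcases hhe with hhl | hue
        · have hh' : h ∈ s(l, u) := heq ▸ Sym2.mem_mk_left h u
          rcases Sym2.mem_iff.1 hh' with rfl | rfl
          · exact hhl rfl
          · exact hu hh
        · exact hue rfl
  · intro x hx y hy
    rw [List.mem_singleton] at hy
    subst hy
    intro hxe
    subst hxe
    exact he (forall_mem_of_mem_edges _ _ hx e (Sym2.mem_mk_right l e))

/-- The vertical edge of the `n`-th `0°`-ray dart. [folklore] -/
theorem adj_rayZero (n : ℤ) :
    hexGraph.Adj (((![n, -1] : Site 2), (1 : Fin 2)) : HexVertex) ((![n, 0] : Site 2), (0 : Fin 2)) := by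
  have h := hexGraph_adj_e1 n (-1)
  norm_num at h
  exact h

/-- The code of the bottom zigzag under the chart. [folklore] -/
theorem zigzag_code (n : ℕ) :
    wOut :: ((cornerIn :: (List.range n).flatMap (fun k : ℕ =>
      [(((![(k : ℤ) + 1, -1] : Site 2), (0 : Fin 2)) : HexVertex), ((![(k : ℤ) + 1, -1] : Site 2), (1 : Fin 2))])).map
        (hvIso.trans HV.flip) ++ [(hvIso.trans HV.flip) (((![(n : ℤ), 0] : Site 2), (0 : Fin 2)) : HexVertex)]) =
    wOut :: hvOrigin ::
      ((List.range n).flatMap (fun k : ℕ => [((-((k : ℤ) + 1), 0, true) : HV), (-((k : ℤ) + 1), 0, false)]) ++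
        [((-(n : ℤ), -1, true) : HV)]) := by
  simp only [List.map_cons, List.map_flatMap, List.map_nil, chart_cornerIn, chart_apply_zero, chart_apply_one,
    neg_neg, sub_self, neg_zero, zero_sub, List.cons_append]

/-- **The bottom zigzag is a self-avoiding walk of `W_N` from the root to the `n`-th `0°`-ray dart, of winding
`+π`** (`n ≥ 1`, outer vertex within radius `N`). [folklore] -/
theorem reflexWedge_rayZero_walk : ∀ (Λ : Finset HexVertex) (N : ℝ), 1 ≤ N → IsReflexWedgeTruncation Λ N → ∀ n : ℕ, 1 ≤ n → ‖hexCenter (((![(n : ℤ), 0] : Site 2), (0 : Fin 2)) : HexVertex)‖ < N → ∃ γ : HexMidEdgeSAW Λ cornerEdge s((((![(n : ℤ), -1] : Site 2), (1 : Fin 2)) : HexVertex), (((![(n : ℤ), 0] : Site 2), (0 : Fin 2)) : HexVertex)), γ.winding = Real.pi := by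
  intro Λ N hN hW n hn hwN
  obtain ⟨hin, hout, hadjc⟩ := reflexWedge_cornerDart Λ N hN hW
  have hbd : cornerEdge ∈ hexDomainBoundary Λ :=
    ⟨(SimpleGraph.mem_edgeSet hexGraph).2 hadjc, cornerOut, cornerIn, Sym2.eq_swap, hin, hout⟩
  obtain ⟨hchain, hlast⟩ := zigzag_chain n
  have hnd := zigzag_nodup n
  have hoV := cornerOut_not_mem_zigzag n
  have hwV := rayZero_outer_not_mem_zigzag n
  set V : List HexVertex := cornerIn :: (List.range n).flatMap (fun k : ℕ =>
      [(((![(k : ℤ) + 1, -1] : Site 2), (0 : Fin 2)) : HexVertex), ((![(k : ℤ) + 1, -1] : Site 2), (1 : Fin 2))]) with hV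
  have hne : V ≠ [] := List.cons_ne_nil _ _
  have hlast' : V.getLast hne = ((![(n : ℤ), -1] : Site 2), (1 : Fin 2)) :=
    Option.some.inj ((List.getLast?_eq_some_getLast hne).symm.trans hlast)
  have hwo : cornerOut ≠ (((![(n : ℤ), 0] : Site 2), (0 : Fin 2)) : HexVertex) := by
    rw [cornerOut, Ne, mk_eq_mk_iff]; omega
  let γ : HexMidEdgeSAW Λ cornerEdge
      s((((![(n : ℤ), -1] : Site 2), (1 : Fin 2)) : HexVertex), (((![(n : ℤ), 0] : Site 2), (0 : Fin 2)) : HexVertex)) :=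
    { verts := V
      subset := zigzag_subset hN hW n hwN
      nodup := hnd
      isChain := hchain
      head_mem := by
        intro x hx
        rw [hV, List.head?_cons, Option.some.injEq] at hx
        rw [← hx, cornerEdge]
        exact Sym2.mem_mk_left _ _
      getLast_mem := by
        intro x hx
        rw [hlast, Option.some.injEq] at hx
        rw [← hx]
        exact Sym2.mem_mk_left _ _
      eq_of_nil := fun h => absurd h hne
      edges_nodup := fun _ => by
        rw [cornerEdge]
        exact edges_nodup_ext hnd hoV hwV List.mem_cons_self (Or.inr hwo)
      fst_mem := hexDomainBoundary_subset Λ hbd }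
  refine ⟨γ, ?_⟩
  have hcode := γ.winding_eq_pturn_code (u := cornerOut) (w₁ := cornerIn) (Φ := hvIso.trans HV.flip)
    (by rw [cornerEdge, Sym2.eq_swap]) hout chart_cornerOut chart_cornerIn (adj_rayZero n)
    chart_affine (by norm_num) hne (e := ((![(n : ℤ), 0] : Site 2), (0 : Fin 2))) (Or.inl ⟨hlast', rfl⟩)
  rw [hcode, show γ.verts = V from rfl, hV, zigzag_code n, pturn_rayZero_code n hn]
  push_cast
  ring

end Summit.CriticalPhenomena.SAWScalingLimit.Theorems.HexConjecture.MarginalWedge.ReflexGeometry
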